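import Summits.FinalStateConjecture.FinalStateConjecture.Theorems.ClusterCompletenessOmegaLimitMultiKerrT2Defs
import Literature.Geometry.Lorentzian.TameGenericityLocalWindowImmersed
import Literature.Geometry.Lorentzian.InitialDataPatch
import HarnessLib

/-!
# Crux `LaminatedThreshold` (stmt-FinalStateConjecture-16893) — TWO-SIDED accumulation is load-bearing: with one-sided accumulation the crux degenerates

Negative support lemma (tightness / load-bearing analysis) for the crux of the REFUTATION route
`LaminatedThreshold` (refuter, cdisprove cycle 1), companion of `Negative/ContinuityLoadBearing`. The
crux asserts `∃ X d⋆ Φ K`: `d⋆` admissible and exceptional, `Φ d⋆ ∈ K` with `K` meeting BOTH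
`(Φ d⋆ − ε, Φ d⋆)` and `(Φ d⋆, Φ d⋆ + ε)` for every `ε > 0`, and along every local family `F` through `d⋆`
(jointly smooth, `F 0 = d⋆`, admissible members, agreeing with `d⋆` off one compact set) there is
`δ > 0` with `Φ ∘ F` continuous on the `δ`-ball and `Φ (F c) ∈ K ⇒ F c` exceptional there.

`oneSided_iff_exists_exceptional`: require accumulation FROM ONE SIDE only (right; the left case is
symmetric) and keep everything else verbatim — the statement becomes EQUIVALENT to the bare existence
of an admissible exceptional datum. The chart of the non-trivial direction is manufactured from `d⋆`
alone: `exists_separating_functional` gives `Φ₀ ≥ 0` on data, `Φ₀ d⋆ = 0`, `Φ₀ D = 0 ⇒ D = d⋆`, with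
`c ↦ Φ₀ (F c)` continuous along EVERY jointly smooth one-parameter family (a geometric series of
truncated operator-norm distances between the point values of `(h, k)` and those of `d⋆` over a dense
sequence of `X`; the fibrewise curves of a smooth family are smooth, `InitialDataSet.contDiffAt_bilin_line`;
smooth sections of the bilinear-form bundle agreeing on a dense set agree, `bilinSection_eq_of_dense`);
then `Φ := −Φ₀`, `K := [0, ∞)`: `Φ (F c) ∈ K` iff `F c = d⋆`, which is exceptional.

Consequence for the line: together with `withoutContinuity_iff_exists_exceptional`, the two clauses that
lift the crux above "some admissible datum is exceptional" are exactly CONTINUITY and TWO-SIDEDNESS; a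
one-sided comb of exceptional leaves (the supercritical comb of spherically symmetric Einstein–SU(2)-σ
collapse, Aichelburg–Bizoń–Tabor, CQG 23 (2006) S299, §3) carries no information here, and any vacuum
comb mechanism must capture the sub-critical branch by a naked attractor too (cf.
`Negative/HalfExitKills`). "Good" is the summit's per-datum property `(∃ MGHD) ∧ ∀ MGHD, SettlesT2`
(`ClusterCompleteness.SettlesT2`, `Iff.rfl` with the route file's block). Folklore differential
topology + Mathlib; no definitions, no named facts.
-/

-- every `Summit.FinalStateConjecture.FinalStateConjecture.…` name repeats the summit = sub-problem segment (D-0017 layout)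
set_option linter.dupNamespace false

noncomputable section

open Set Filter Metric Function TopologicalSpace
open scoped Manifold ContDiff Topology

namespace Summit.FinalStateConjecture.FinalStateConjecture.Theorems.LaminatedThreshold.Negative

open Literature.Geometry.Lorentzian
open Summit.FinalStateConjecture.FinalStateConjecture.Theorems.ClusterCompleteness (SettlesT2)

section TwoSided

open Bundle

-- operator norms on `E3 →L[ℝ] E3 →L[ℝ] ℝ` and the Hom-bundle instances are deep (as in
-- `TameGenericityLocalWindowImmersed`)
set_option maxSynthPendingDepth 3
set_option synthInstance.maxHeartbeats 120000
set_option maxHeartbeats 1600000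

variable {X : Type} [TopologicalSpace X] [ChartedSpace E3 X] [IsManifold (𝓡 3) ∞ X]

/-- **Smooth sections of the bundle of bilinear forms on `TX` that agree on a dense set agree.**
Read both sections through the trivialization at `x₀`: the readings are continuous on its (open)
base set (`Trivialization.contMDiffOn_section_baseSet_iff`), agree on a dense subset of it, hence on
all of it (`Set.EqOn.of_subset_closure`), and the trivialization is injective on fibres. [folklore] -/
theorem bilinSection_eq_of_dense
    {σ₁ σ₂ : Π x : X, TangentSpace (𝓡 3) x →L[ℝ] TangentSpace (𝓡 3) x →L[ℝ] ℝ}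
    (h₁ : ContMDiff (𝓡 3) ((𝓡 3).prod 𝓘(ℝ, E3 →L[ℝ] E3 →L[ℝ] ℝ)) ∞
      (fun x : X ↦ TotalSpace.mk' (E3 →L[ℝ] E3 →L[ℝ] ℝ)
        (E := fun x : X ↦ TangentSpace (𝓡 3) x →L[ℝ] TangentSpace (𝓡 3) x →L[ℝ] ℝ) x (σ₁ x)))
    (h₂ : ContMDiff (𝓡 3) ((𝓡 3).prod 𝓘(ℝ, E3 →L[ℝ] E3 →L[ℝ] ℝ)) ∞
      (fun x : X ↦ TotalSpace.mk' (E3 →L[ℝ] E3 →L[ℝ] ℝ)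
        (E := fun x : X ↦ TangentSpace (𝓡 3) x →L[ℝ] TangentSpace (𝓡 3) x →L[ℝ] ℝ) x (σ₂ x)))
    {S : Set X} (hS : Dense S) (heq : ∀ x ∈ S, σ₁ x = σ₂ x) : σ₁ = σ₂ := by
  funext x₀
  set e := trivializationAt (E3 →L[ℝ] E3 →L[ℝ] ℝ)
    (fun x : X ↦ TangentSpace (𝓡 3) x →L[ℝ] TangentSpace (𝓡 3) x →L[ℝ] ℝ) x₀ with he
  have hx₀ : x₀ ∈ e.baseSet := FiberBundle.mem_baseSet_trivializationAt' x₀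
  have hr₁ : ContinuousOn (fun x ↦ (e ⟨x, σ₁ x⟩).2) e.baseSet :=
    ((e.contMDiffOn_section_baseSet_iff (IB := 𝓡 3) (n := ∞)).1 h₁.contMDiffOn).continuousOn
  have hr₂ : ContinuousOn (fun x ↦ (e ⟨x, σ₂ x⟩).2) e.baseSet :=
    ((e.contMDiffOn_section_baseSet_iff (IB := 𝓡 3) (n := ∞)).1 h₂.contMDiffOn).continuousOn
  have hEqS : EqOn (fun x ↦ (e ⟨x, σ₁ x⟩).2) (fun x ↦ (e ⟨x, σ₂ x⟩).2) (e.baseSet ∩ S) := by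
    intro x hx
    simp only [heq x hx.2]
  have hEq : EqOn (fun x ↦ (e ⟨x, σ₁ x⟩).2) (fun x ↦ (e ⟨x, σ₂ x⟩).2) e.baseSet :=
    hEqS.of_subset_closure hr₁ hr₂ inter_subset_left (hS.open_subset_closure_inter e.open_baseSet)
  have h2 : (e ⟨x₀, σ₁ x₀⟩).2 = (e ⟨x₀, σ₂ x₀⟩).2 := hEq hx₀
  rw [← e.symm_apply_apply_mk hx₀ (σ₁ x₀), ← e.symm_apply_apply_mk hx₀ (σ₂ x₀), h2]

variable [SecondCountableTopology X] [ConnectedSpace X]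

/-- **A curve-wise continuous functional separating `d⋆` from every other datum.** For every datum
`d⋆` there is `Φ₀ : data → ℝ`, `Φ₀ ≥ 0`, `Φ₀ d⋆ = 0`, `Φ₀ D = 0 ⇒ D = d⋆`, such that `c ↦ Φ₀ (F c)` is
continuous for every jointly smooth one-parameter family `F` (no base point, admissibility or
support condition needed): `Φ₀ D = ∑ₙ 2⁻ⁿ min (1, ‖h_D(xₙ) − h_{d⋆}(xₙ)‖ + ‖k_D(xₙ) − k_{d⋆}(xₙ)‖)` over a
dense sequence `(xₙ)` of `X` (second countable, non-empty since connected), the norms being the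
operator norms on `E3 →L E3 →L ℝ = T_x X →L T_x X →L ℝ`. [folklore] -/
theorem exists_separating_functional (dstar : InitialDataSet (𝓡 3) X) :
    ∃ Φ₀ : InitialDataSet (𝓡 3) X → ℝ,
      Φ₀ dstar = 0 ∧ (∀ D, 0 ≤ Φ₀ D) ∧ (∀ D, Φ₀ D = 0 → D = dstar) ∧
        ∀ F : EuclideanSpace ℝ (Fin 1) → InitialDataSet (𝓡 3) X,
          InitialDataSet.IsSmoothDataFamily 1 F → Continuous fun c ↦ Φ₀ (F c) := by
  obtain ⟨u, hu⟩ := TopologicalSpace.exists_dense_seq X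
  -- truncated distance of the point values at `u n`
  let a : ℕ → InitialDataSet (𝓡 3) X → ℝ := fun n D ↦
    ‖(show E3 →L[ℝ] E3 →L[ℝ] ℝ from D.h.inner (u n)) -
        (show E3 →L[ℝ] E3 →L[ℝ] ℝ from dstar.h.inner (u n))‖ +
      ‖(show E3 →L[ℝ] E3 →L[ℝ] ℝ from D.k (u n)) - (show E3 →L[ℝ] E3 →L[ℝ] ℝ from dstar.k (u n))‖
  let term : ℕ → InitialDataSet (𝓡 3) X → ℝ := fun n D ↦ (1 / 2 : ℝ) ^ n * min 1 (a n D)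
  have ha0 : ∀ n D, 0 ≤ a n D := fun n D ↦ add_nonneg (norm_nonneg _) (norm_nonneg _)
  have hterm0 : ∀ n D, 0 ≤ term n D := fun n D ↦
    mul_nonneg (pow_nonneg (by norm_num) n) (le_min zero_le_one (ha0 n D))
  have htermle : ∀ n D, term n D ≤ (1 / 2 : ℝ) ^ n := fun n D ↦ by
    have : min 1 (a n D) ≤ 1 := min_le_left _ _
    calc term n D = (1 / 2 : ℝ) ^ n * min 1 (a n D) := rfl
      _ ≤ (1 / 2 : ℝ) ^ n * 1 := by gcongr
      _ = (1 / 2 : ℝ) ^ n := mul_one _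
  have hgeom : Summable fun n : ℕ ↦ (1 / 2 : ℝ) ^ n :=
    summable_geometric_of_lt_one (by norm_num) (by norm_num)
  have hsum : ∀ D, Summable fun n ↦ term n D := fun D ↦
    Summable.of_nonneg_of_le (hterm0 · D) (htermle · D) hgeom
  refine ⟨fun D ↦ ∑' n, term n D, ?_, fun D ↦ tsum_nonneg (hterm0 · D), ?_, ?_⟩
  · -- `Φ₀ d⋆ = 0`
    have : ∀ n, term n dstar = 0 := fun n ↦ by simp [term, a]
    simp [this]
  · -- `Φ₀ D = 0 ⇒ D = d⋆`
    intro D hD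
    have hall : ∀ n, term n D = 0 := by
      intro n
      by_contra hne
      have hpos : 0 < term n D := lt_of_le_of_ne (hterm0 n D) (Ne.symm hne)
      have := (hsum D).tsum_pos (hterm0 · D) n hpos
      linarith
    have hpt : ∀ n, D.h.inner (u n) = dstar.h.inner (u n) ∧ D.k (u n) = dstar.k (u n) := by
      intro n
      have h1 : min 1 (a n D) = 0 := by
        have := hall n
        simp only [term, mul_eq_zero, pow_eq_zero_iff', one_div, inv_eq_zero] at this
        rcases this with ⟨h, -⟩ | h
        · norm_num at h
        · exact h
      have h2 : a n D = 0 := by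
        rcases min_choice 1 (a n D) with h | h
        · rw [h] at h1; exact absurd h1 one_ne_zero
        · rw [h] at h1; exact h1
      have h3 := (add_eq_zero_iff_of_nonneg (norm_nonneg _) (norm_nonneg _)).1 h2
      have e1 : (show E3 →L[ℝ] E3 →L[ℝ] ℝ from D.h.inner (u n)) =
          (show E3 →L[ℝ] E3 →L[ℝ] ℝ from dstar.h.inner (u n)) :=
        sub_eq_zero.1 (norm_eq_zero.1 h3.1)
      have e2 : (show E3 →L[ℝ] E3 →L[ℝ] ℝ from D.k (u n)) =
          (show E3 →L[ℝ] E3 →L[ℝ] ℝ from dstar.k (u n)) :=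
        sub_eq_zero.1 (norm_eq_zero.1 h3.2)
      exact ⟨e1, e2⟩
    have hh : D.h.inner = dstar.h.inner :=
      bilinSection_eq_of_dense D.h.contMDiff dstar.h.contMDiff (S := Set.range u) hu
        (by rintro _ ⟨n, rfl⟩; exact (hpt n).1)
    have hk : D.k = dstar.k :=
      bilinSection_eq_of_dense D.contMDiff_k dstar.contMDiff_k (S := Set.range u) hu
        (by rintro _ ⟨n, rfl⟩; exact (hpt n).2)
    exact InitialDataSet.ext_of_sections (fun x ↦ congrFun hh x) (fun x ↦ congrFun hk x)
  · -- continuity along smooth families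
    intro F hF
    -- along the axis `s ↦ F (s e₀)`
    have hline : Continuous fun s : ℝ ↦ ∑' n, term n (F (EuclideanSpace.single 0 s)) := by
      refine continuous_tsum (fun n ↦ ?_) hgeom fun n s ↦ ?_
      · have hH : Continuous fun s : ℝ ↦
            (show E3 →L[ℝ] E3 →L[ℝ] ℝ from (F (EuclideanSpace.single 0 s)).h.inner (u n)) :=
          continuous_iff_continuousAt.2 fun t ↦
            (InitialDataSet.contDiffAt_bilin_line (σ := fun c x ↦ (F c).h.inner x) hF.1 (u n) t).continuousAt
        have hK : Continuous fun s : ℝ ↦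
            (show E3 →L[ℝ] E3 →L[ℝ] ℝ from (F (EuclideanSpace.single 0 s)).k (u n)) :=
          continuous_iff_continuousAt.2 fun t ↦
            (InitialDataSet.contDiffAt_bilin_line (σ := fun c x ↦ (F c).k x) hF.2 (u n) t).continuousAt
        exact continuous_const.mul (continuous_const.min
          (((hH.sub continuous_const).norm).add ((hK.sub continuous_const).norm)))
      · rw [Real.norm_eq_abs, abs_of_nonneg (hterm0 n _)]
        exact htermle n _
    have hfac : (fun c : EuclideanSpace ℝ (Fin 1) ↦ ∑' n, term n (F c)) =
        (fun s : ℝ ↦ ∑' n, term n (F (EuclideanSpace.single 0 s))) ∘ fun c ↦ c 0 := by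
      funext c
      simp only [Function.comp_apply, InitialDataSet.single_apply_zero_eq]
    rw [hfac]
    exact hline.comp (PiLp.continuous_apply 2 (fun _ : Fin 1 ↦ ℝ) 0)

/-- **With ONE-SIDED accumulation the crux degenerates** to the bare existence of an admissible
exceptional datum. Left: `LaminatedThreshold` verbatim except that `K` is only required to
accumulate at `Φ d⋆` FROM THE RIGHT. (→) forget the chart; (←) `Φ := −Φ₀` for the separating
functional of `exists_separating_functional`, `K := [0, ∞)`, `δ := 1`: `Φ ∘ F` is continuous along
every smooth family, and `Φ (F c) ∈ K` iff `Φ₀ (F c) = 0` iff `F c = d⋆`, which is exceptional. So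
the two-sided accumulation demanded by the crux is exactly what lifts it above "some admissible
datum is exceptional"; one-sided combs (e.g. the supercritical comb of Einstein–SU(2)-σ collapse,
Aichelburg–Bizoń–Tabor 2006) give nothing. (The mirror statement with accumulation from the left is
the same with `Φ := Φ₀`, `K := (−∞, 0]`.) [folklore] -/
theorem oneSided_iff_exists_exceptional :
    (∃ (X : Type) (_ : TopologicalSpace X) (_ : ChartedSpace E3 X) (_ : IsManifold (𝓡 3) ∞ X)
      (_ : T2Space X) (_ : SecondCountableTopology X) (_ : ConnectedSpace X)
      (dstar : InitialDataSet (𝓡 3) X) (Φ : InitialDataSet (𝓡 3) X → ℝ) (K : Set ℝ),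
      dstar ∈ admissibleVacuumData X ∧
      ¬ ((∃ 𝒟 : VacuumCauchyDevelopment dstar, 𝒟.IsMaximal) ∧
          ∀ 𝒟 : VacuumCauchyDevelopment dstar, 𝒟.IsMaximal → SettlesT2 𝒟) ∧
      Φ dstar ∈ K ∧
      (∀ ε : ℝ, 0 < ε → (K ∩ Set.Ioo (Φ dstar) (Φ dstar + ε)).Nonempty) ∧
      ∀ F : EuclideanSpace ℝ (Fin 1) → InitialDataSet (𝓡 3) X,
        InitialDataSet.IsSmoothDataFamily 1 F → F 0 = dstar → (∀ c, F c ∈ admissibleVacuumData X) →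
        (∃ C : Set X, IsCompact C ∧
          ∀ c, ∀ x ∉ C, (F c).h.inner x = dstar.h.inner x ∧ (F c).k x = dstar.k x) →
        ∃ δ : ℝ, 0 < δ ∧ ContinuousOn (fun c ↦ Φ (F c)) (Metric.ball 0 δ) ∧
          ∀ c ∈ Metric.ball (0 : EuclideanSpace ℝ (Fin 1)) δ, Φ (F c) ∈ K →
            ¬ ((∃ 𝒟 : VacuumCauchyDevelopment (F c), 𝒟.IsMaximal) ∧
                ∀ 𝒟 : VacuumCauchyDevelopment (F c), 𝒟.IsMaximal → SettlesT2 𝒟)) ↔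
    ∃ (X : Type) (_ : TopologicalSpace X) (_ : ChartedSpace E3 X) (_ : IsManifold (𝓡 3) ∞ X)
      (_ : T2Space X) (_ : SecondCountableTopology X) (_ : ConnectedSpace X)
      (dstar : InitialDataSet (𝓡 3) X),
      dstar ∈ admissibleVacuumData X ∧
      ¬ ((∃ 𝒟 : VacuumCauchyDevelopment dstar, 𝒟.IsMaximal) ∧
          ∀ 𝒟 : VacuumCauchyDevelopment dstar, 𝒟.IsMaximal → SettlesT2 𝒟) := by
  constructor
  · rintro ⟨X, i₁, i₂, i₃, i₄, i₅, i₆, dstar, Φ, K, hadm, hbad, -, -, -⟩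
    exact ⟨X, i₁, i₂, i₃, i₄, i₅, i₆, dstar, hadm, hbad⟩
  · rintro ⟨X, i₁, i₂, i₃, i₄, i₅, i₆, dstar, hadm, hbad⟩
    obtain ⟨Φ₀, h0, hnn, hsep, hcont⟩ := exists_separating_functional dstar
    refine ⟨X, i₁, i₂, i₃, i₄, i₅, i₆, dstar, fun D ↦ -Φ₀ D, Set.Ici 0, hadm, hbad, ?_, ?_, ?_⟩
    · simp [h0]
    · intro ε hε
      refine ⟨ε / 2, ?_, ?_⟩
      · show (0 : ℝ) ≤ ε / 2
        linarith
      · simp only [h0, neg_zero, zero_add]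
        constructor <;> linarith
    · intro F hF _ _ _
      refine ⟨1, one_pos, (hcont F hF).neg.continuousOn, fun c _ hcK ↦ ?_⟩
      have hzero : Φ₀ (F c) = 0 := le_antisymm (by simpa using hcK) (hnn (F c))
      rw [hsep (F c) hzero]
      exact hbad

end TwoSided

end Summit.FinalStateConjecture.FinalStateConjecture.Theorems.LaminatedThreshold.Negative

end
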